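import Summits.CriticalPhenomena.Ising3DConformalLimit.Theorems.HyperoctahedralRPLimitRotationInvariantQuarterTurnDefs
import Literature.MathematicalPhysics.QuantumFieldTheory.MirrorInPlaneLightCone
import Literature.MathematicalPhysics.QuantumFieldTheory.MirrorOSDataOfBounds
import Literature.MathematicalPhysics.QuantumFieldTheory.LatticeB2Bisectors
import Literature.Uncategorized.DiamondCross
import HarnessLib

/-!
# Crux `HyperoctahedralRP.LimitRotationInvariant` (stmt-CriticalPhenomena-1980), line `quarter-turn-liouville`:
stub S2b `stub_inPlaneLightCone` — the in-plane light cone of every `B₂` pair of lattice mirrors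

`DiamondCross → ∀ Δ S, LimitStructure Δ S → InPlaneLightCone S`: for every `B₂` pair `(n, n')` of
lattice mirror normals of `ℤ³` and all finite real cluster combinations strictly inside
`{⟪·, n⟫ > 0}`, the two-cluster matrix element `(t, y) ↦ Σ c_a d_b S(θ_n A^a ⊔ (B^b + t n + y n'))`
is the restriction of a function holomorphic on the tube `|Im y| < Re t` and bounded there by the
product of the two OS norms (Glimm–Jaffe §19.5 INVERTED: the spectral light cone `|P| ≤ H` of the
frame-`n` energy–momentum pair from reflection positivity in the two BISECTING lattice mirrors).

All the mathematics is in the tree (landed for this stub):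
* `Literature.MathematicalPhysics.QuantumFieldTheory.exists_holomorphic_twoCluster_of_bisectorOSData`
  (`MirrorInPlaneLightCone.lean`; built on `MirrorHalfSpaceClusters`, `MirrorClusterOSSpace` — the
  kernel-level OS reconstruction of a mirror via `KernelEnergyMomentumPair` /
  `SemigroupJointSpectralMeasure` —, `MirrorBisectorHalfPlane`, `MirrorInPlaneConeSupport`, and
  `Literature.Analysis.Complex.{AnalyticCharFunExpMoments (Lukacs), LaplaceFourierCone (pinning, tube),
  TubeKernelCauchySchwarz (Glaser ⇒ sharp bound)}`);
* `mirrorOSData_of_bounds`, `clusterRP_smul_normal` (`MirrorOSDataOfBounds.lean`) and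
  `exists_bisectors_of_B2Pair` (`LatticeB2Bisectors.lean`).
This file only unpacks `LimitStructure` for the nine lattice normals (`θ_v` is a signed permutation,
so hyperoctahedral invariance gives `θ_v`-invariance; nine-mirror RP; normalisation, Gaussian
domination and continuity give the kernel bounds) and for the bisectors `n ± n' = c • m`.
-/

noncomputable section

open scoped BigOperators InnerProductSpace
open Literature.Probability.LatticeModels
open Literature.MathematicalPhysics.QuantumFieldTheory
open Literature.Uncategorized (DiamondCross)

namespace Summit.CriticalPhenomena.Ising3DConformalLimit.Cruxes.LimitRotationInvariant.QuarterTurnLiouville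

/-- The reflection in a lattice mirror of `ℤ³` is a signed coordinate permutation
(`(i,-i)`, `(i,j)(-i,-j)`, `(i,-j)(-i,j)` of the hyperoctahedral group). -/
theorem refl_latticeNormal_eq_signedPerm {v : EuclideanSpace ℝ (Fin 3)} (hv : v ∈ latticeMirrorNormals (Fin 3)) :
    ∃ (σ : Equiv.Perm (Fin 3)) (ε : Fin 3 → Bool), ∀ x : EuclideanSpace ℝ (Fin 3), refl v x = signedPerm σ ε x := by
  obtain ⟨i, j, hij, rfl | rfl | rfl⟩ := hv
  · refine ⟨Equiv.refl _, fun l => decide (l ≠ i), fun x => ?_⟩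
    ext l
    rw [refl, reflection_single_apply]
    simp only [signedPerm, PiLp.toLp_apply, Equiv.refl_apply, decide_eq_true_eq, ne_eq, ite_not]
    split_ifs <;> ring
  · refine ⟨Equiv.swap i j, fun l => decide (l ≠ i ∧ l ≠ j), fun x => ?_⟩
    ext l
    rw [refl, reflection_single_add_single_apply hij]
    simp only [signedPerm, PiLp.toLp_apply, decide_eq_true_eq, ne_eq]
    by_cases hli : l = i
    · subst hli; simp [Equiv.swap_apply_left]
    · by_cases hlj : l = j
      · subst hlj; simp [hli, Equiv.swap_apply_right]
      · simp [hli, hlj, Equiv.swap_apply_of_ne_of_ne hli hlj]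
  · refine ⟨Equiv.swap i j, fun _ => true, fun x => ?_⟩
    ext l
    rw [refl, reflection_single_sub_single_apply hij]
    simp [signedPerm]

/-- Hence a hyperoctahedrally invariant family is invariant under every lattice mirror reflection. -/
theorem reflInvariant_latticeNormal {S : CorrFamily 3} (hS : IsHyperoctahedralInvariant S) {v : EuclideanSpace ℝ (Fin 3)}
    (hv : v ∈ latticeMirrorNormals (Fin 3)) (N : ℕ) (x : Fin N → EuclideanSpace ℝ (Fin 3)) :
    S N (fun i => refl v (x i)) = S N x := by
  obtain ⟨σ, ε, h⟩ := refl_latticeNormal_eq_signedPerm hv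
  simp only [h]
  exact hS N σ ε x

/-- **Kernel-level OS data of a limit in the frame of any nonzero multiple of a lattice normal**:
from `LimitStructure` — nine-mirror RP (transported to `c • v` by `clusterRP_smul_normal`),
`θ_v`-invariance (hyperoctahedral invariance), permutation symmetry, translation invariance,
normalisation off `NonCoincident`, Gaussian domination and continuity (`mirrorOSData_of_bounds`). -/
theorem mirrorOSData_smul_latticeNormal {Δ : ℝ} {S : CorrFamily 3} (hL : LimitStructure Δ S) {v : EuclideanSpace ℝ (Fin 3)}
    (hv : v ∈ latticeMirrorNormals (Fin 3)) {c : ℝ} (hc : c ≠ 0) : MirrorOSData S (c • v) := by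
  obtain ⟨⟨_, htr, _, hnorm, _, hO, hperm, hpd, hcont⟩, hRP⟩ := hL
  have hrefl : ∀ (N : ℕ) (x : Fin N → EuclideanSpace ℝ (Fin 3)), S N (fun i => refl v (x i)) = S N x :=
    reflInvariant_latticeNormal hO hv
  refine mirrorOSData_of_bounds (smul_ne_zero hc (ne_zero_of_mem_latticeMirrorNormals hv))
    (clusterRP_smul_normal (hRP v hv) hrefl hc) (reflectionInvariant_smul_normal hrefl hc) hperm htr
    (fun N x hx => hnorm N x hx) ?_ hcont
  obtain ⟨C, hC⟩ := hpd
  exact ⟨fun N r => C ^ (N + 1) * (Nat.factorial N : ℝ) * r ^ (-(N : ℝ) * Δ), fun N x r hr hsep => hC N x r hr hsep⟩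

/-- The same for the lattice normal itself (`c = 1`). -/
theorem mirrorOSData_latticeNormal {Δ : ℝ} {S : CorrFamily 3} (hL : LimitStructure Δ S) {v : EuclideanSpace ℝ (Fin 3)}
    (hv : v ∈ latticeMirrorNormals (Fin 3)) : MirrorOSData S v := by
  simpa using mirrorOSData_smul_latticeNormal hL hv one_ne_zero

/-- **S2b · `stub_inPlaneLightCone`.**  For every `B₂` pair `(n, n')` of lattice mirror normals the
two bisectors `n ± n'` are nonzero multiples of lattice mirror normals (`exists_bisectors_of_B2Pair`),
so a limit with `LimitStructure` carries kernel-level OS data in the frames `n`, `n + n'`, `n - n'`,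
and the in-plane light cone is `exists_holomorphic_twoCluster_of_bisectorOSData` (Glimm–Jaffe §19.5
inverted: bisector half-planes, `DiamondCross`, Thales, Lukacs, support pinning, Glaser). -/
theorem stub_inPlaneLightCone :
    DiamondCross → ∀ (Δ : ℝ) (S : CorrFamily 3), LimitStructure Δ S → InPlaneLightCone S := by
  intro hD Δ S hL n hn n' hn' horth hlen m k A c m' k' B d hA hB
  obtain ⟨⟨c₁, m₁, hc₁, hm₁, h₁⟩, ⟨c₂, m₂, hc₂, hm₂, h₂⟩⟩ := exists_bisectors_of_B2Pair hn hn' horth hlen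
  have h₀ : MirrorOSData S n := mirrorOSData_latticeNormal hL hn
  have hb₁ : MirrorOSData S (n + n') := by rw [h₁]; exact mirrorOSData_smul_latticeNormal hL hm₁ hc₁
  have hb₂ : MirrorOSData S (n - n') := by rw [h₂]; exact mirrorOSData_smul_latticeNormal hL hm₂ hc₂
  exact exists_holomorphic_twoCluster_of_bisectorOSData hD h₀ hb₁ hb₂ horth hlen m k A c m' k' B d hA hB

end Summit.CriticalPhenomena.Ising3DConformalLimit.Cruxes.LimitRotationInvariant.QuarterTurnLiouville

end
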